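import Mathlib.Analysis.SpecificLimits.Basic

/-!
# RemainderExplicitHistoryDiagonalKernel — ROAD P3: THE DIAGONAL KERNEL of station S-d4p3-g47-1 «existence without NE4 as typed» —
# a nonnegative array `δ K j` (cutoff `K`, scale `j ≤ K`) obeying the column-form two-run recursion
# `δ K j ≤ Σ_{l∈[j,K)} σ_l + Σ_{i<K} (Σ_{a∈[j∸i,K−i)} ρ_a)·u_{K−i}·δ K i` with `Σσ ≤ S`, `Σρ ≤ W`, `n·u_n ≤ κ`, `Wκ < 1` has
# DIAGONAL SUMS `Σ_{n<N} δ (n+m) n ≤ m·S∕(1 − Wκ)` — summable over the cutoff at every fixed infrared distance `m`, linearly in `m`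
# (pure finite sums; `RemainderExplicitHistoryDiagonalSum` feeds node U2's recursion into it)

Cell `pub-balaban`, β-function sub-cell, BINDER row D4 «RemainderConst leaves for Bałaban's split» (`HOME/BINDER-OWNERS.md`; owner
lineage `b2b-balaban-beta-an4`; this file by co-owner #3 lineage `b2b-balaban-beta-d4-p3`, road P3 «the reduction road», generation 47,
station S-d4p3-g47-1, kernel file; imports Mathlib only), β-FLOW TEAM duty (1); FREEZE (0) honoured (def-free module in road P3's own
`RemainderExplicit*` series; no leaf, no interface, no Literature file).  SOURCE OF THE SHAPES ONLY: [Balaban1987RG1] (0.20) p. 256,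
(0.31) and Thm 2 p. 259 (two infrared-pinned runs of the coupling recursion compared at matched scales — node U2 of the cell's T4-DAG,
`T4CouplingMatching`; the array `δ K j` below is ANY nonnegative array, the theorem is arithmetic).

HONEST FRAMING (page 1 of everything the β sub-cell writes).  *"Discharging BetaPertH makes Bałaban's UV stability UNCONDITIONAL —
a real constructive-QFT result; it is NOT the continuum limit and NOT the Clay problem."*  THIS FILE DISCHARGES NOTHING OF THE
KIND.  It is elementary arithmetic: the summation over the CUTOFF, along the diagonals of fixed infrared distance, of a backward
recursion whose source is a summable PROFILE `σ` (no geometric rate) and whose two-sided feedback is governed by a summable memory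
PROFILE `ρ` (no fading-memory rate) and weights `u` with `n·u_n` bounded (the asymptotic-freedom weights `g³ ≲ (b·n)^{−3∕2}` at
infrared distance `n` have this and no more is used).  The point of the station (located census distinction, answer to journal
[D4P2-G35-X20] INFO-1): EXISTENCE of the continuum coupling scale by scale costs only `ℓ¹` — summable scale shift, summable memory,
the floor `b ≤ β`, the smallness `(Σρ)·γ < b`; the geometric shapes of NE4 as typed and `FadingMemory` buy the K-uniform RATE.
Nothing of Bałaban's (1.22) is asserted or constructed; row D4 class UNCHANGED (critical-path width 0; instance 0∕1; D4 DISCHARGE NO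
DATE); NOT B12 Thm 2, NOT BetaPertH, NOT continuum, NOT Clay.  HONEST DEPENDENCY: continuum YM on T⁴ ⇐ BetaPertH ∧ nine spine
estimates (0/9 proved); BetaPertH ⇐ (D1) ∧ (D4) ∧ CAP+tail; G-an2-4 gates asym, D1 and NE2/3/4.  ABSOLUTE RULE: nothing is cited as
a fact.

WHAT IS PROVED ([folklore]; 0 sorry; 0 `def`; all over ABSTRACT nonnegative real arrays).
* §1 COUNTING: `sum_window_le` (`Σ_{m′<L} Σ_{a∈[m′∸m, m′)} ρ_a ≤ m·W`: every age lies in at most `m` windows); `sum_shift_le`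
  (`Σ_{n<N} σ_{n+d} ≤ S`); `sum_source_windows_le` (`Σ_{n<N} Σ_{l∈[n,n+m)} σ_l ≤ m·S`).
* §2 DIAGONAL COORDINATES: `diag_entry_le` (the recursion at `K = n + m`, `j = n`, the feedback reflected to infrared distances
  `m″ + 1 = K − i`); `sum_filter_diag_le` (the entries at infrared distance `m″+1` of the cutoffs `< L` re-indexed injectively into the
  diagonal sum `F (m″+1)`); `diag_system`: `F m ≤ m·S + Σ_{m″<L} (Σ_{a∈[m″+1∸m, m″+1)} ρ_a)·u_{m″+1}·F (m″+1)` for the diagonal sums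
  `F m = Σ_{n<L∸m} δ (n+m) n` over the cutoffs `< L`.
* §3 **`diag_sum_le`**: `Σ_{n<N} δ (n+m) n ≤ m·S∕(1 − Wκ)` for every `m, N` — the MAXIMAL RATIO `Q = max_{1≤m≤L} F m∕m` obeys
  `Q ≤ S + Q·κ·W` (`sum_window_le`), and `F 0 = 0` is forced by the recursion at `j = K`.  No geometric series anywhere; the bound is
  linear in `m` and uniform in the number of cutoffs, i.e. node U6's summable-discrepancy currency at each fixed infrared distance.
All letters NOT-IN-PRINT; `BetaFlowAsPrinted S` records a Markov β_n only ⇒ no junction of the as-printed interface changes.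
-/

noncomputable section

open Finset

namespace Summit.QuantumFields.BalabanUV.Beta.RemainderExplicitHistoryDiagonalKernel

/-! ## §1 Counting: windows and shifted sums -/

/-- WINDOW COUNT: for `ρ` with partial sums `≤ W`, `Σ_{m'<L} Σ_{a∈[m'∸m, m')} ρ_a ≤ m·W` — each age `a` lies in the window
`[m'∸m, m')` for at most `m` values of `m'` (induction on `m`: widening the window by one adds the single age `m' − m − 1`). [folklore] -/
theorem sum_window_le {ρ : ℕ → ℝ} {W : ℝ} (hρW : ∀ n, ∑ a ∈ range n, ρ a ≤ W) :
    ∀ m L : ℕ, ∑ m' ∈ range L, ∑ a ∈ Ico (m' - m) m', ρ a ≤ (m : ℝ) * W := by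
  intro m
  induction m with
  | zero => intro L; simp
  | succ m ih =>
    intro L
    have hstep : ∀ m', ∑ a ∈ Ico (m' - (m + 1)) m', ρ a
        ≤ (∑ a ∈ Ico (m' - m) m', ρ a) + (if m + 1 ≤ m' then ρ (m' - (m + 1)) else 0) := by
      intro m'
      by_cases h : m + 1 ≤ m'
      · rw [if_pos h]
        have hlt : m' - (m + 1) < m' := by omega
        rw [Finset.sum_eq_sum_Ico_succ_bot hlt, show m' - (m + 1) + 1 = m' - m by omega]
        linarith
      · rw [if_neg h, add_zero, show m' - (m + 1) = m' - m by omega]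
    have hind : ∑ m' ∈ range L, (if m + 1 ≤ m' then ρ (m' - (m + 1)) else 0) ≤ W := by
      rw [← Finset.sum_filter]
      have hset : (range L).filter (fun m' => m + 1 ≤ m') = Ico (m + 1) L := by
        ext m'; simp [Finset.mem_filter, Finset.mem_Ico, and_comm]
      rw [hset, Finset.sum_Ico_eq_sum_range]
      calc ∑ k ∈ range (L - (m + 1)), ρ (m + 1 + k - (m + 1))
          = ∑ k ∈ range (L - (m + 1)), ρ k := Finset.sum_congr rfl fun k _ => by rw [Nat.add_sub_cancel_left]
        _ ≤ W := hρW _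
    calc ∑ m' ∈ range L, ∑ a ∈ Ico (m' - (m + 1)) m', ρ a
        ≤ ∑ m' ∈ range L, ((∑ a ∈ Ico (m' - m) m', ρ a) + (if m + 1 ≤ m' then ρ (m' - (m + 1)) else 0)) :=
          Finset.sum_le_sum fun m' _ => hstep m'
      _ = (∑ m' ∈ range L, ∑ a ∈ Ico (m' - m) m', ρ a)
            + ∑ m' ∈ range L, (if m + 1 ≤ m' then ρ (m' - (m + 1)) else 0) := Finset.sum_add_distrib
      _ ≤ (m : ℝ) * W + W := add_le_add (ih L) hind
      _ = ((m + 1 : ℕ) : ℝ) * W := by push_cast; ring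

/-- SHIFTED PARTIAL SUMS: for `σ ≥ 0` with partial sums `≤ S`, `Σ_{n<N} σ_{n+d} ≤ S`. [folklore] -/
theorem sum_shift_le {σ : ℕ → ℝ} {S : ℝ} (hσ0 : ∀ l, 0 ≤ σ l) (hσS : ∀ n, ∑ l ∈ range n, σ l ≤ S) (N d : ℕ) :
    ∑ n ∈ range N, σ (n + d) ≤ S := by
  have e : ∑ n ∈ range N, σ (n + d) = ∑ l ∈ Ico d (N + d), σ l := by
    rw [Finset.sum_Ico_eq_sum_range, show N + d - d = N by omega]
    exact Finset.sum_congr rfl fun n _ => by rw [add_comm]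
  rw [e]
  exact (Finset.sum_le_sum_of_subset_of_nonneg (fun l hl => Finset.mem_range.mpr (Finset.mem_Ico.mp hl).2)
    (fun l _ _ => hσ0 l)).trans (hσS (N + d))

/-- SOURCE WINDOWS ALONG A DIAGONAL: `Σ_{n<N} Σ_{l∈[n,n+m)} σ_l ≤ m·S` — each `σ_l` is counted at most `m` times. [folklore] -/
theorem sum_source_windows_le {σ : ℕ → ℝ} {S : ℝ} (hσ0 : ∀ l, 0 ≤ σ l) (hσS : ∀ n, ∑ l ∈ range n, σ l ≤ S)
    (N m : ℕ) : ∑ n ∈ range N, ∑ l ∈ Ico n (n + m), σ l ≤ (m : ℝ) * S := by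
  have e : ∀ n, ∑ l ∈ Ico n (n + m), σ l = ∑ d ∈ range m, σ (n + d) := by
    intro n
    rw [Finset.sum_Ico_eq_sum_range, show n + m - n = m by omega]
  simp_rw [e]
  rw [Finset.sum_comm]
  calc ∑ d ∈ range m, ∑ n ∈ range N, σ (n + d) ≤ ∑ _d ∈ range m, S :=
        Finset.sum_le_sum fun d _ => sum_shift_le hσ0 hσS N d
    _ = (m : ℝ) * S := by rw [Finset.sum_const, Finset.card_range, nsmul_eq_mul]

/-! ## §2 Diagonal coordinates and the linear system of the diagonal sums -/

/-- ONE DIAGONAL ENTRY IN DIAGONAL COORDINATES: for `K = n + m`, `j = n`, the column-form recursion reads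
`δ (n+m) n ≤ Σ_{l∈[n,n+m)} σ_l + Σ_{m''<n+m} (Σ_{a∈[m''+1∸m, m''+1)} ρ_a)·u_{m''+1}·δ (n+m) (n+m−1−m'')` (reflect `i = n+m−1−m''`).
[folklore] -/
theorem diag_entry_le {δ : ℕ → ℕ → ℝ} {σ ρ u : ℕ → ℝ}
    (hrec : ∀ K j, j ≤ K → δ K j ≤ (∑ l ∈ Ico j K, σ l)
      + ∑ i ∈ range K, (∑ a ∈ Ico (j - i) (K - i), ρ a) * u (K - i) * δ K i) (n m : ℕ) :
    δ (n + m) n ≤ (∑ l ∈ Ico n (n + m), σ l)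
      + ∑ m'' ∈ range (n + m), (∑ a ∈ Ico (m'' + 1 - m) (m'' + 1), ρ a) * u (m'' + 1)
          * δ (n + m) (n + m - 1 - m'') := by
  have h := hrec (n + m) n (Nat.le_add_right n m)
  have e : ∑ i ∈ range (n + m), (∑ a ∈ Ico (n - i) (n + m - i), ρ a) * u (n + m - i) * δ (n + m) i
      = ∑ m'' ∈ range (n + m), (∑ a ∈ Ico (m'' + 1 - m) (m'' + 1), ρ a) * u (m'' + 1)
          * δ (n + m) (n + m - 1 - m'') := by
    rw [← Finset.sum_range_reflect (fun i => (∑ a ∈ Ico (n - i) (n + m - i), ρ a) * u (n + m - i) * δ (n + m) i)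
      (n + m)]
    refine Finset.sum_congr rfl fun m'' hm'' => ?_
    have hm : m'' < n + m := Finset.mem_range.mp hm''
    have e1 : n - (n + m - 1 - m'') = m'' + 1 - m := by omega
    have e2 : n + m - (n + m - 1 - m'') = m'' + 1 := by omega
    rw [e1, e2]
  rw [e] at h
  exact h

/-- THE FEEDBACK OF ONE INFRARED DISTANCE INTO A DIAGONAL SUM: for nonnegative `δ` and fixed `m, m'', L`,
`Σ_{n<L∸m, m''<n+m} δ (n+m) (n+m−1−m'') ≤ Σ_{n'<L∸(m''+1)} δ (n'+m''+1) n'` — the entries at infrared distance `m''+1` of the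
cutoffs `n + m < L`, re-indexed injectively by `n' = n + m − 1 − m''`. [folklore] -/
theorem sum_filter_diag_le {δ : ℕ → ℕ → ℝ} (hδ0 : ∀ K j, 0 ≤ δ K j) (m m'' L : ℕ) :
    ∑ n ∈ (range (L - m)).filter (fun n => m'' < n + m), δ (n + m) (n + m - 1 - m'')
      ≤ ∑ n' ∈ range (L - (m'' + 1)), δ (n' + m'' + 1) n' := by
  classical
  set s := (range (L - m)).filter (fun n => m'' < n + m) with hs
  have hinj : Set.InjOn (fun n => n + m - 1 - m'') (s : Set ℕ) := by
    intro x hx y hy hxy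
    have hx' := (Finset.mem_filter.mp (Finset.mem_coe.mp hx)).2
    have hy' := (Finset.mem_filter.mp (Finset.mem_coe.mp hy)).2
    simp only at hxy
    omega
  have e : ∑ n ∈ s, δ (n + m) (n + m - 1 - m'')
      = ∑ n' ∈ s.image (fun n => n + m - 1 - m''), δ (n' + m'' + 1) n' := by
    rw [Finset.sum_image hinj]
    refine Finset.sum_congr rfl fun n hn => ?_
    have hn' := (Finset.mem_filter.mp hn).2
    rw [show n + m - 1 - m'' + m'' + 1 = n + m by omega]
  rw [e]
  refine Finset.sum_le_sum_of_subset_of_nonneg (fun n' hn' => ?_) (fun _ _ _ => hδ0 _ _)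
  obtain ⟨n, hn, rfl⟩ := Finset.mem_image.mp hn'
  have h1 := Finset.mem_filter.mp hn
  have h2 := Finset.mem_range.mp h1.1
  exact Finset.mem_range.mpr (by omega)

/-- THE DIAGONAL SUMS OBEY A LINEAR SYSTEM: with `F m := Σ_{n<L∸m} δ (n+m) n` (all cutoffs `< L`), nonnegative data and the column-form
recursion, `F m ≤ m·S + Σ_{m''<L} (Σ_{a∈[m''+1∸m, m''+1)} ρ_a)·u_{m''+1}·F (m''+1)`. [folklore] -/
theorem diag_system {δ : ℕ → ℕ → ℝ} {σ ρ u : ℕ → ℝ} {S : ℝ}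
    (hδ0 : ∀ K j, 0 ≤ δ K j) (hσ0 : ∀ l, 0 ≤ σ l) (hρ0 : ∀ a, 0 ≤ ρ a) (hu0 : ∀ n, 0 ≤ u n)
    (hσS : ∀ n, ∑ l ∈ range n, σ l ≤ S)
    (hrec : ∀ K j, j ≤ K → δ K j ≤ (∑ l ∈ Ico j K, σ l)
      + ∑ i ∈ range K, (∑ a ∈ Ico (j - i) (K - i), ρ a) * u (K - i) * δ K i) (L m : ℕ) :
    ∑ n ∈ range (L - m), δ (n + m) n ≤ (m : ℝ) * S
      + ∑ m'' ∈ range L, (∑ a ∈ Ico (m'' + 1 - m) (m'' + 1), ρ a) * u (m'' + 1)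
          * ∑ n' ∈ range (L - (m'' + 1)), δ (n' + m'' + 1) n' := by
  classical
  -- entrywise, with the inner feedback sum extended to the rectangle `m'' < L` by an indicator
  have hentry : ∀ n ∈ range (L - m), δ (n + m) n ≤ (∑ l ∈ Ico n (n + m), σ l)
      + ∑ m'' ∈ range L, if m'' < n + m then
          (∑ a ∈ Ico (m'' + 1 - m) (m'' + 1), ρ a) * u (m'' + 1) * δ (n + m) (n + m - 1 - m'') else 0 := by
    intro n hn
    have hnL : n + m ≤ L := by have := Finset.mem_range.mp hn; omega
    refine (diag_entry_le hrec n m).trans (add_le_add le_rfl (le_of_eq ?_))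
    rw [← Finset.sum_filter]
    congr 1
    ext m''
    simp only [Finset.mem_range, Finset.mem_filter]
    omega
  refine (Finset.sum_le_sum hentry).trans ?_
  rw [Finset.sum_add_distrib]
  refine add_le_add (sum_source_windows_le hσ0 hσS _ _) ?_
  rw [Finset.sum_comm]
  refine Finset.sum_le_sum fun m'' _ => ?_
  rw [← Finset.sum_filter, ← Finset.mul_sum]
  exact mul_le_mul_of_nonneg_left (sum_filter_diag_le hδ0 m m'' L)
    (mul_nonneg (Finset.sum_nonneg fun a _ => hρ0 a) (hu0 _))

/-! ## §3 The maximal-ratio fixed point -/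

/-- **THE DIAGONAL KERNEL.**  Nonnegative arrays `δ K j` obeying, for `j ≤ K`, the column-form recursion
`δ K j ≤ Σ_{l∈[j,K)} σ_l + Σ_{i<K} (Σ_{a∈[j∸i,K−i)} ρ_a)·u_{K−i}·δ K i` with `σ, ρ, u ≥ 0`, `Σ_{l<n} σ_l ≤ S`, `Σ_{a<n} ρ_a ≤ W`,
`n·u_n ≤ κ` and the smallness `W·κ < 1` have diagonal sums bounded LINEARLY in the infrared distance and UNIFORMLY in the number
of cutoffs: `Σ_{n<N} δ (n+m) n ≤ m·S∕(1 − Wκ)`.  Proof: for the cutoffs `< L` the diagonal sums `F` obey `diag_system`; the maximal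
ratio `Q = max_{1≤m≤L} F m ∕ m` satisfies `Q ≤ S + Q·κ·W` by `sum_window_le`; no geometric series. [folklore] -/
theorem diag_sum_le {δ : ℕ → ℕ → ℝ} {σ ρ u : ℕ → ℝ} {S W κ : ℝ}
    (hδ0 : ∀ K j, 0 ≤ δ K j) (hσ0 : ∀ l, 0 ≤ σ l) (hρ0 : ∀ a, 0 ≤ ρ a) (hu0 : ∀ n, 0 ≤ u n)
    (hσS : ∀ n, ∑ l ∈ range n, σ l ≤ S) (hρW : ∀ n, ∑ a ∈ range n, ρ a ≤ W)
    (hκ : ∀ n : ℕ, (n : ℝ) * u n ≤ κ) (hq : W * κ < 1)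
    (hrec : ∀ K j, j ≤ K → δ K j ≤ (∑ l ∈ Ico j K, σ l)
      + ∑ i ∈ range K, (∑ a ∈ Ico (j - i) (K - i), ρ a) * u (K - i) * δ K i) :
    ∀ m N : ℕ, ∑ n ∈ range N, δ (n + m) n ≤ (m : ℝ) * S / (1 - W * κ) := by
  classical
  have hS0 : 0 ≤ S := by simpa using hσS 0
  have hW0 : 0 ≤ W := by simpa using hρW 0
  have hκ0 : 0 ≤ κ := by simpa using hκ 0
  have hq' : 0 < 1 - W * κ := by linarith
  -- it suffices to bound the diagonal sums over the cutoffs `< L` for every `L`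
  suffices H : ∀ L m : ℕ, ∑ n ∈ range (L - m), δ (n + m) n ≤ (m : ℝ) * S / (1 - W * κ) by
    intro m N
    have h := H (N + m) m
    rwa [Nat.add_sub_cancel] at h
  intro L
  set F : ℕ → ℝ := fun m => ∑ n ∈ range (L - m), δ (n + m) n with hF
  have hF0 : ∀ m, 0 ≤ F m := fun m => Finset.sum_nonneg fun n _ => hδ0 _ _
  have hsys : ∀ m, F m ≤ (m : ℝ) * S
      + ∑ m'' ∈ range L, (∑ a ∈ Ico (m'' + 1 - m) (m'' + 1), ρ a) * u (m'' + 1) * F (m'' + 1) := by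
    intro m
    have h := diag_system hδ0 hσ0 hρ0 hu0 hσS hrec L m
    exact h
  -- the maximal ratio over `1 ≤ m ≤ L`
  by_cases hL : L = 0
  · intro m
    have : L - m = 0 := by omega
    rw [this, Finset.sum_range_zero]
    positivity
  have hne : (Finset.Icc 1 L).Nonempty := ⟨1, Finset.mem_Icc.mpr ⟨le_rfl, Nat.one_le_iff_ne_zero.mpr hL⟩⟩
  obtain ⟨m₀, hm₀, hmax⟩ := Finset.exists_max_image (Finset.Icc 1 L) (fun m => F m / m) hne
  set Q : ℝ := F m₀ / m₀ with hQ
  have hm₀1 : (1 : ℝ) ≤ m₀ := by exact_mod_cast (Finset.mem_Icc.mp hm₀).1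
  have hm₀pos : (0 : ℝ) < m₀ := by linarith
  have hQ0 : 0 ≤ Q := div_nonneg (hF0 _) hm₀pos.le
  -- every diagonal sum is at most `Q·m`
  have hFQ : ∀ m, F m ≤ Q * m := by
    intro m
    by_cases hm : m = 0
    · -- `F 0 = 0` (the pin is forced by the recursion at `j = K`)
      subst hm
      have h0 : F 0 ≤ 0 := by
        refine (hsys 0).trans (le_of_eq ?_)
        simp
      simp only [Nat.cast_zero, mul_zero]
      exact h0
    by_cases hmL : m ≤ L
    · have h := hmax m (Finset.mem_Icc.mpr ⟨Nat.one_le_iff_ne_zero.mpr hm, hmL⟩)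
      have hmpos : (0 : ℝ) < m := by exact_mod_cast Nat.pos_of_ne_zero hm
      calc F m = F m / m * m := by field_simp
        _ ≤ Q * m := mul_le_mul_of_nonneg_right h hmpos.le
    · have : L - m = 0 := by omega
      simp only [hF, this, Finset.sum_range_zero]
      positivity
  -- the fixed-point inequality at the maximiser
  have hwin : ∑ m'' ∈ range L, (∑ a ∈ Ico (m'' + 1 - m₀) (m'' + 1), ρ a) * u (m'' + 1) * F (m'' + 1)
      ≤ Q * κ * ((m₀ : ℝ) * W) := by
    calc ∑ m'' ∈ range L, (∑ a ∈ Ico (m'' + 1 - m₀) (m'' + 1), ρ a) * u (m'' + 1) * F (m'' + 1)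
        ≤ ∑ m'' ∈ range L, (∑ a ∈ Ico (m'' + 1 - m₀) (m'' + 1), ρ a) * (Q * κ) := by
          refine Finset.sum_le_sum fun m'' _ => ?_
          have hc0 : 0 ≤ ∑ a ∈ Ico (m'' + 1 - m₀) (m'' + 1), ρ a := Finset.sum_nonneg fun a _ => hρ0 a
          rw [mul_assoc]
          refine mul_le_mul_of_nonneg_left ?_ hc0
          calc u (m'' + 1) * F (m'' + 1) ≤ u (m'' + 1) * (Q * ((m'' + 1 : ℕ) : ℝ)) :=
                mul_le_mul_of_nonneg_left (hFQ _) (hu0 _)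
            _ = Q * (((m'' + 1 : ℕ) : ℝ) * u (m'' + 1)) := by ring
            _ ≤ Q * κ := mul_le_mul_of_nonneg_left (hκ _) hQ0
      _ = (Q * κ) * ∑ m'' ∈ range L, ∑ a ∈ Ico (m'' + 1 - m₀) (m'' + 1), ρ a := by
          rw [Finset.mul_sum]; exact Finset.sum_congr rfl fun _ _ => by ring
      _ ≤ (Q * κ) * ((m₀ : ℝ) * W) := by
          refine mul_le_mul_of_nonneg_left ?_ (mul_nonneg hQ0 hκ0)
          have h := sum_window_le hρW m₀ (L + 1)
          rw [Finset.sum_range_succ'] at h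
          have h0 : 0 ≤ ∑ a ∈ Ico (0 - m₀) 0, ρ a := Finset.sum_nonneg fun a _ => hρ0 a
          linarith
  have hfix : Q * m₀ ≤ (m₀ : ℝ) * S + Q * κ * ((m₀ : ℝ) * W) := by
    have h := hsys m₀
    have e : F m₀ = Q * m₀ := by rw [hQ]; field_simp
    linarith
  have hQle : Q ≤ S / (1 - W * κ) := by
    rw [le_div_iff₀ hq']
    have : Q * m₀ * (1 - W * κ) ≤ m₀ * S := by nlinarith
    nlinarith
  intro m
  calc ∑ n ∈ range (L - m), δ (n + m) n = F m := rfl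
    _ ≤ Q * m := hFQ m
    _ ≤ S / (1 - W * κ) * m := mul_le_mul_of_nonneg_right hQle (Nat.cast_nonneg m)
    _ = (m : ℝ) * S / (1 - W * κ) := by ring

end Summit.QuantumFields.BalabanUV.Beta.RemainderExplicitHistoryDiagonalKernel

end
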